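/-
Copyright (c) 2026. All rights reserved.
Released under Apache 2.0 license as described in the file LICENSE.
Authors: abc-iut cell — seat abc-iut-f-095 (gen 6; proof-only companion of `HolomorphicCores.lean` /
`HolomorphicCoresFunctorialityProofs.lean` (abc-iut-L4-t8): the functoriality clause of [AbsTopIII]
Cor 2.4 RE-CLOSED at the category `HolRS` of connected Riemann surfaces — K4 row of node
`AbsTopIII:Cor2.4`, binder `hf : IsFiniteEtale f` (FACT-LIST F-2449)).
-/
import Literature.AnabelianGeometry.AbsoluteAnabelian.HolomorphicCoresFunctorialityProofs
import Literature.AnabelianGeometry.AbsoluteAnabelian.ArchimedeanHolFieldFunctorGeometricPSLPlaneComplFiniteType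
import Literature.Topology.CoveringSpaces.UniversalCoverSecondCountable
import HarnessLib

/-!
# [AbsTopIII] Cor 2.4, functoriality clause, along the morphisms of `HolRS` (proof-only)

S. Mochizuki, *Topics in absolute anabelian geometry III*, Cor 2.4 (kurims p.55 l.11–12): «the asserted
"functoriality" is with respect to finite étale morphisms of Aut-holomorphic spaces arising from
hyperbolic curves over `ℂ`» [cite: MochizukiAbsTopIII2015, Corollary 2.4 p.55].

abc-iut cell, layer L4, K4 hygiene of node `AbsTopIII:Cor2.4` (abc-iut-c312-2 `CONE-K4-RECLOSE.tsv` v4: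
class RECLOSABLE, «0/1 rows INHABITED»).  The node's closing theorems `cor24_functorial` /
`cor24_functorial_of_nonabelian_fundamentalGroup` (abc-iut-L4-t8, `HolomorphicCoresFunctorialityProofs`)
bind the FACT-LIST predicate row F-2449 `IsFiniteEtale f` as a hypothesis `hf` on an abstract map
`f : X′ → X`; the universal closure of a predicate row is of course refuted, and the SURVIVING INSTANCE
FORM is structure-borne: every morphism `φ : Y ⟶ X` of abc-iut-L4-t10's category `HolRS` of connected
Riemann surfaces and holomorphic finite étale maps (`ArchimedeanHolFieldFunctorGeometric`, [AbsTopIII]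
Def 4.1 (iii)) carries `φ.isFiniteEtale` and `φ.mdifferentiable`.  This file RE-CLOSES the node at
that instance form, with no new definition and no new named fact:

* `HolRS.cor24_functorial_hom` — the functoriality clause along EVERY morphism `φ : Y ⟶ X` of `HolRS`
  with `X` of finite type and `π₁(Y)` non-abelian: binders `hf`, `hfd` DISCHARGED by the structure of
  `φ`, and the second countability of `Y` (a binder of the L4-t8 closer) DISCHARGED as well — `X` of
  finite type is second countable (abc-iut-w5-d096, `HolRS.secondCountableTopology_of_isOfFiniteType`)
  and a covering with finite fibres over a second countable base is second countable
  (`Literature.Topology.CoveringSpaces.secondCountableTopology_of_isCoveringMap`, Lee Thm. 7.21);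
* `HolRS.cor24_functorial_hom_planeComplFinite` — the same over the genuine base `ℂ ∖ F` (`F` finite;
  abc-iut-L4-t12's `HolRS.planeComplFinite`), the finite-type binder discharged by abc-iut-w5-d096's
  `HolRS.isOfFiniteType_planeComplFinite`; only the base point and «`π₁(Y)` non-abelian» remain;
* `HolRS.cor24_functorial_id_planeComplFinite` — ZERO binders: the clause at the identity morphism of
  `ℂ ∖ F`, `2 ≤ |F|`, every base point (non-abelian `π₁(ℂ ∖ F)`:
  `Literature.AlgebraicTopology.FundamentalGroup.exists_mul_ne_mul_fundamentalGroup_compl_finite`).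

Classical material (covering spaces, Riemann surfaces); refereed pre-IUT; nothing here bears on the
disputed [IUTchIII] Cor. 3.12; no side is taken; re-closed ≠ endorsed.
-/

noncomputable section

namespace Literature.AnabelianGeometry.AbsoluteAnabelian

open _root_.TopologicalSpace _root_.Topology _root_.Set _root_.Function _root_.CategoryTheory
open scoped _root_.Manifold _root_.ContDiff
open Literature.Topology.CoveringSpaces

namespace HolRS

/-- The source of a morphism of `HolRS` into a Riemann surface of finite type is second countable: the
target is second countable (`secondCountableTopology_of_isOfFiniteType`) and a covering map with finite
fibres over a second countable base is second countable (`secondCountableTopology_of_isCoveringMap`).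
[cite: Lee2011TopologicalManifolds, Thm. 7.21] -/
theorem secondCountableTopology_source_of_isOfFiniteType {Y X : HolRS} (φ : Y ⟶ X)
    (hX : IsOfFiniteType X.carrier) : SecondCountableTopology Y.carrier := by
  haveI := secondCountableTopology_of_isOfFiniteType X hX
  exact secondCountableTopology_of_isCoveringMap φ.isFiniteEtale.isCoveringMap
    fun x => (φ.isFiniteEtale.finite_fibre x).countable.to_subtype

/-- **[AbsTopIII] Cor 2.4, the functoriality clause, along EVERY morphism `φ : Y ⟶ X` of `HolRS`**
(connected Riemann surfaces with holomorphic finite étale maps, Def 4.1 (iii)) **whose target is of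
finite type and whose source has non-abelian fundamental group** — i.e. at every finite étale morphism of
hyperbolic Riemann surfaces of finite type, print's class: abc-iut-L4-t8's
`cor24_functorial_of_nonabelian_fundamentalGroup` with its binders `hf : IsFiniteEtale f` (FACT-LIST
F-2449), `hfd` (holomorphy) and `[SecondCountableTopology X′]` DISCHARGED by the structure of `φ` and
`secondCountableTopology_source_of_isOfFiniteType`.  Conclusion verbatim: a universal covering
`p : 𝔻 → Y` by the unit disc exists, `φ ∘ p : 𝔻 → X` is again a (surjective, holomorphic) universal
covering, `Aut(𝔻/Y) ≤ Aut(𝔻/X)` with finite index, both inside `Aut⁰(𝔻)`, and for `G = Aut⁰(𝔻)` the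
commensurators `Π`, the arithmeticity verdicts and the core data of `Y` and `X` agree.
[cite: MochizukiAbsTopIII2015, Corollary 2.4 p.55] -/
theorem cor24_functorial_hom {Y X : HolRS} (φ : Y ⟶ X) (hX : IsOfFiniteType X.carrier) (y : Y.carrier)
    (hπ : ∃ a b : FundamentalGroup Y.carrier y, a * b ≠ b * a) :
    ∃ p : unitDiscOpens → Y.carrier, IsCoveringMap p ∧ Function.Surjective p ∧
      MDifferentiable 𝓘(ℂ, ℂ) 𝓘(ℂ, ℂ) p ∧
      (IsCoveringMap (φ.toFun ∘ p) ∧ Function.Surjective (φ.toFun ∘ p) ∧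
        MDifferentiable 𝓘(ℂ, ℂ) 𝓘(ℂ, ℂ) (φ.toFun ∘ p)) ∧
      (deckGroup p ≤ deckGroup (φ.toFun ∘ p) ∧
        (deckGroup p).relIndex (deckGroup (φ.toFun ∘ p)) ≠ 0) ∧
      (((deckGroup p : Subgroup (unitDiscOpens ≃ₜ unitDiscOpens)) :
            Set (unitDiscOpens ≃ₜ unitDiscOpens)) ⊆
          autIdComponent (AutHolStructure.ofCharted unitDiscOpens) ∧
        ((deckGroup (φ.toFun ∘ p) : Subgroup (unitDiscOpens ≃ₜ unitDiscOpens)) :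
            Set (unitDiscOpens ≃ₜ unitDiscOpens)) ⊆
          autIdComponent (AutHolStructure.ofCharted unitDiscOpens)) ∧
      ∀ G : Subgroup (unitDiscOpens ≃ₜ unitDiscOpens),
        (G : Set (unitDiscOpens ≃ₜ unitDiscOpens)) =
            autIdComponent (AutHolStructure.ofCharted unitDiscOpens) →
          Subgroup.Commensurable.commensurator ((deckGroup p).subgroupOf G) =
              Subgroup.Commensurable.commensurator ((deckGroup (φ.toFun ∘ p)).subgroupOf G) ∧
            (IsMargulisNonArithmetic G (deckGroup p) ↔
              IsMargulisNonArithmetic G (deckGroup (φ.toFun ∘ p))) ∧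
            (Subgroup.Commensurable.commensurator ((deckGroup p).subgroupOf G)).map G.subtype =
              (Subgroup.Commensurable.commensurator ((deckGroup (φ.toFun ∘ p)).subgroupOf G)).map
                G.subtype := by
  haveI := secondCountableTopology_source_of_isOfFiniteType φ hX
  exact cor24_functorial_of_nonabelian_fundamentalGroup X.carrier Y.carrier φ.isFiniteEtale
    φ.mdifferentiable hX y hπ

/-- **[AbsTopIII] Cor 2.4, functoriality clause, along every morphism `φ : Y ⟶ ℂ ∖ F` of `HolRS`**
(`F ⊆ ℂ` finite; abc-iut-L4-t12's `planeComplFinite`), the finite-type binder discharged by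
abc-iut-w5-d096's `isOfFiniteType_planeComplFinite`: only a base point `y` and «`π₁(Y, y)` non-abelian»
remain. [cite: MochizukiAbsTopIII2015, Corollary 2.4 p.55] -/
theorem cor24_functorial_hom_planeComplFinite {F : Set ℂ} (hF : F.Finite) {Y : HolRS}
    (φ : Y ⟶ planeComplFinite F hF) (y : Y.carrier)
    (hπ : ∃ a b : FundamentalGroup Y.carrier y, a * b ≠ b * a) :
    ∃ p : unitDiscOpens → Y.carrier, IsCoveringMap p ∧ Function.Surjective p ∧
      MDifferentiable 𝓘(ℂ, ℂ) 𝓘(ℂ, ℂ) p ∧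
      (IsCoveringMap (φ.toFun ∘ p) ∧ Function.Surjective (φ.toFun ∘ p) ∧
        MDifferentiable 𝓘(ℂ, ℂ) 𝓘(ℂ, ℂ) (φ.toFun ∘ p)) ∧
      (deckGroup p ≤ deckGroup (φ.toFun ∘ p) ∧
        (deckGroup p).relIndex (deckGroup (φ.toFun ∘ p)) ≠ 0) ∧
      (((deckGroup p : Subgroup (unitDiscOpens ≃ₜ unitDiscOpens)) :
            Set (unitDiscOpens ≃ₜ unitDiscOpens)) ⊆
          autIdComponent (AutHolStructure.ofCharted unitDiscOpens) ∧
        ((deckGroup (φ.toFun ∘ p) : Subgroup (unitDiscOpens ≃ₜ unitDiscOpens)) :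
            Set (unitDiscOpens ≃ₜ unitDiscOpens)) ⊆
          autIdComponent (AutHolStructure.ofCharted unitDiscOpens)) ∧
      ∀ G : Subgroup (unitDiscOpens ≃ₜ unitDiscOpens),
        (G : Set (unitDiscOpens ≃ₜ unitDiscOpens)) =
            autIdComponent (AutHolStructure.ofCharted unitDiscOpens) →
          Subgroup.Commensurable.commensurator ((deckGroup p).subgroupOf G) =
              Subgroup.Commensurable.commensurator ((deckGroup (φ.toFun ∘ p)).subgroupOf G) ∧
            (IsMargulisNonArithmetic G (deckGroup p) ↔
              IsMargulisNonArithmetic G (deckGroup (φ.toFun ∘ p))) ∧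
            (Subgroup.Commensurable.commensurator ((deckGroup p).subgroupOf G)).map G.subtype =
              (Subgroup.Commensurable.commensurator ((deckGroup (φ.toFun ∘ p)).subgroupOf G)).map
                G.subtype :=
  cor24_functorial_hom φ (isOfFiniteType_planeComplFinite hF) y hπ

/-- **[AbsTopIII] Cor 2.4, functoriality clause, ZERO binders, at the identity morphism of `ℂ ∖ F`**
(`F ⊆ ℂ` finite with `2 ≤ |F|`, every base point `x`): finite type by abc-iut-w5-d096's
`isOfFiniteType_planeComplFinite`, non-abelian `π₁(ℂ ∖ F, x) ≅ F_{|F|}` by abc-iut-L4-t7's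
`exists_mul_ne_mul_fundamentalGroup_compl_finite`, `IsFiniteEtale`/holomorphy by the structure of
`𝟙 (ℂ ∖ F)` in `HolRS` — the K4 closer `cor24_functorial_of_nonabelian_fundamentalGroup` APPLIED at a
genuine carrier with nothing assumed. [cite: MochizukiAbsTopIII2015, Corollary 2.4 p.55] -/
theorem cor24_functorial_id_planeComplFinite {F : Set ℂ} (hF : F.Finite) (h2 : 2 ≤ F.ncard)
    (x : (planeComplFinite F hF).carrier) :
    ∃ p : unitDiscOpens → (planeComplFinite F hF).carrier, IsCoveringMap p ∧ Function.Surjective p ∧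
      MDifferentiable 𝓘(ℂ, ℂ) 𝓘(ℂ, ℂ) p ∧
      (IsCoveringMap ((𝟙 (planeComplFinite F hF) : _ ⟶ _).toFun ∘ p) ∧
        Function.Surjective ((𝟙 (planeComplFinite F hF) : _ ⟶ _).toFun ∘ p) ∧
        MDifferentiable 𝓘(ℂ, ℂ) 𝓘(ℂ, ℂ) ((𝟙 (planeComplFinite F hF) : _ ⟶ _).toFun ∘ p)) ∧
      (deckGroup p ≤ deckGroup ((𝟙 (planeComplFinite F hF) : _ ⟶ _).toFun ∘ p) ∧
        (deckGroup p).relIndex (deckGroup ((𝟙 (planeComplFinite F hF) : _ ⟶ _).toFun ∘ p)) ≠ 0) ∧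
      (((deckGroup p : Subgroup (unitDiscOpens ≃ₜ unitDiscOpens)) :
            Set (unitDiscOpens ≃ₜ unitDiscOpens)) ⊆
          autIdComponent (AutHolStructure.ofCharted unitDiscOpens) ∧
        ((deckGroup ((𝟙 (planeComplFinite F hF) : _ ⟶ _).toFun ∘ p) :
              Subgroup (unitDiscOpens ≃ₜ unitDiscOpens)) : Set (unitDiscOpens ≃ₜ unitDiscOpens)) ⊆
          autIdComponent (AutHolStructure.ofCharted unitDiscOpens)) ∧
      ∀ G : Subgroup (unitDiscOpens ≃ₜ unitDiscOpens),
        (G : Set (unitDiscOpens ≃ₜ unitDiscOpens)) =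
            autIdComponent (AutHolStructure.ofCharted unitDiscOpens) →
          Subgroup.Commensurable.commensurator ((deckGroup p).subgroupOf G) =
              Subgroup.Commensurable.commensurator
                ((deckGroup ((𝟙 (planeComplFinite F hF) : _ ⟶ _).toFun ∘ p)).subgroupOf G) ∧
            (IsMargulisNonArithmetic G (deckGroup p) ↔
              IsMargulisNonArithmetic G (deckGroup ((𝟙 (planeComplFinite F hF) : _ ⟶ _).toFun ∘ p))) ∧
            (Subgroup.Commensurable.commensurator ((deckGroup p).subgroupOf G)).map G.subtype =
              (Subgroup.Commensurable.commensurator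
                ((deckGroup ((𝟙 (planeComplFinite F hF) : _ ⟶ _).toFun ∘ p)).subgroupOf G)).map
                  G.subtype :=
  cor24_functorial_hom_planeComplFinite hF (𝟙 (planeComplFinite F hF)) x
    (Literature.AlgebraicTopology.FundamentalGroup.exists_mul_ne_mul_fundamentalGroup_compl_finite hF h2 x)

end HolRS

end Literature.AnabelianGeometry.AbsoluteAnabelian

end
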